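import Summits.ResolutionOfSingularities.ResolutionOfSingularities.Theorems.PurelyInseparableDim4EquimultipleCover
import Summits.ResolutionOfSingularities.ResolutionOfSingularities.Theorems.PurelyInseparableDim4Perm2BoundOrigin
import Summits.ResolutionOfSingularities.ResolutionOfSingularities.Theorems.PurelyInseparableDim4MohAlong
import Literature.Barriers.ResolutionOfSingularities.ResidualOrderUnboundedBlowup
import Literature.AlgebraicGeometry.Resolution.PointBlowupKangaroo
import HarnessLib

/-!
# Purely inseparable four-folds: the closed order-`p` points of the transform over the centre ARE the edges of the
# coordinate-centre walk (brick TY-3f «EDGE DICTIONARY», cell `res-dim4-pi`)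

[OURS · counted 0] (D-0157 DOOR 2; junction of S3 (b) — files `…Equimultiple*.lean`, typ-2's `…Chart*.lean` — with the
TARGET FRAME `PurelyInseparableDim4Target.lean`; host item stmt-ResolutionOfSingularities-16155, helper). Nothing here
proves resolution of singularities in dimension ≥ 4 / characteristic `p`.

The target frame's one-step relation is `PIDim4.Edge q S s s' := ∃ j b, j ∈ S ∧ b_j = 0 ∧ IsEquimultiplePoint q S j b s ∧
(step q S j b s).F ≠ 0 ∧ s' = step q S j b s`. TY-3e/ChartCover identified the closed order-`p` points of the controlled
transform with the pairs `(j, (a, b))`, `IsEquimultiplePoint p S j b s`; over the centre `b_j = 0`. The remaining clause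
`(step p S j b s).F ≠ 0` is settled here for EVERY point `b` (the tree's `CentreBlowup.step_F_ne_zero` covers only the fibre
over the origin): a clean non-zero `F` with `p ≤ ord_{(x_S)} F` has a clean non-zero chart transform (p-2's
`Perm2Bound.deletePthPowers_chartTransform`), and translating a polynomial that is not a sum of `p`-th-power monomials
never produces one (`deletePthPowers_translate_eq_zero`, from p-1's `MohAlong.deletePthPowers_translate_monomial_eq_zero`
applied to the inverse translation).

* `deletePthPowers_translate_eq_zero` — `deletePthPowers p G = 0 → deletePthPowers p (G(x + b)) = 0` (char `p`);
* `chartTransform_ne_zero`, **`step_F_ne_zero_of_isClean`** — `F ≠ 0` clean, `p ≤ ord_{(x_S)} F`, `j ∈ S` ⇒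
  `(step p S j b s).F ≠ 0` for every `b`;
* **`edge_step_of_isEquimultiplePoint`** — such `s`, `b_j = 0`, `IsEquimultiplePoint` ⇒ `Edge p S s (step p S j b s)`;
* **`exists_edge_of_le_idealOrder`** — `K` algebraically closed, `π` ANY blowing up along the permissible `V(z, x_S)`:
  a CLOSED point `w` of `W` OVER THE CENTRE with `ord_w σᶜ((z^p + F), p) ≥ p` is `chartImm_j (a, b)` for an EDGE
  `Edge p S s (step p S j b s)` of the frame (with `a^p + F′_j(b) = 0`);
* `exists_point_of_edge` — conversely every edge `Edge p S s s'` is realised by a point `chartImm_j (a, b)` of `W` over the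
  centre at which the controlled transform has order `≥ p` (`K` algebraically closed, so `a = (−F′_j(b))^{1/p}` exists).

AI-produced formalisation, weaker than expert review. bears_on: LADDER-RESOLUTION:D157-DOOR2 (res-dim4-pi · TY-3f).
-/

set_option linter.dupNamespace false -- D-0017: single-problem summit path `Summit.<S>.<S>.…` by design

noncomputable section

open MvPolynomial Finset CategoryTheory AlgebraicGeometry Opposite

namespace Summit.ResolutionOfSingularities.ResolutionOfSingularities.Theorems.PIDim4

open Literature.AlgebraicGeometry.Resolution
open Literature.AlgebraicGeometry.Resolution.Hauser2010
open Literature.AlgebraicGeometry.Resolution.AffinePointBlowup (P A γ coord Wtop)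
open Literature.Barriers.ResolutionOfSingularities

namespace Equimultiple

/-! ## §1 Translations do not create `p`-th powers; the step polynomial is never zero -/

section StepNeZero

variable {σ : Type*} {K : Type*} [Field K] [Fintype σ] [DecidableEq σ] [DecidableEq K]
variable {p : ℕ} [hp : Fact p.Prime] [CharP K p]

omit [Fintype σ] [DecidableEq K] in
/-- **Translating a sum of `p`-th-power monomials gives a sum of `p`-th-power monomials** (characteristic `p`:
`(x + b)^{p·e} = (x^p + b^p)^e`): `deletePthPowers p G = 0 ⇒ deletePthPowers p (G(x + b)) = 0`. [folklore] -/
theorem deletePthPowers_translate_eq_zero (b : σ → K) {G : MvPolynomial σ K} (hG : deletePthPowers p G = 0) :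
    deletePthPowers p (PointBlowup.translate b G) = 0 := by
  classical
  have hsupp : ∀ d ∈ G.support, IsPthPowerExponent p d := by
    intro d hd
    by_contra hnp
    have h := congrArg (coeff d) hG
    rw [coeff_deletePthPowers, if_neg hnp, coeff_zero] at h
    exact (MvPolynomial.mem_support_iff.mp hd) h
  conv_lhs => rw [G.as_sum]
  unfold PointBlowup.translate
  rw [map_sum, CentreBlowup.deletePthPowers_finset_sum]
  refine Finset.sum_eq_zero fun d hd => ?_
  have h := MohAlong.deletePthPowers_translate_monomial_eq_zero p 1 b (D := d) (by rw [pow_one]; exact hsupp d hd)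
    (coeff d G)
  rw [pow_one] at h
  exact h

omit [Fintype σ] [DecidableEq K] hp [CharP K p] in
/-- The chart transform of a non-zero `F` with `q ≤ ord_{(x_S)} F` (`j ∈ S`) is non-zero (the exponent map is
injective on the permissible range, p-2's `Perm2Bound.mem_support_chartTransform_iff`). [folklore] -/
theorem chartTransform_ne_zero {q : ℕ} {S : Finset σ} {j : σ} (hj : j ∈ S) {F : MvPolynomial σ K} (hF : F ≠ 0)
    (hperm : (q : ℕ∞) ≤ CentreBlowup.ordAlong S F) : CentreBlowup.chartTransform q S j F ≠ 0 := by
  have hq : ∀ e ∈ F.support, q ≤ CentreBlowup.degIn S e := fun e he => by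
    have h : CentreBlowup.ordAlong S F ≤ (CentreBlowup.degIn S e : ℕ∞) := Finset.inf_le he
    exact_mod_cast hperm.trans h
  obtain ⟨e, he⟩ : F.support.Nonempty :=
    Finset.nonempty_iff_ne_empty.mpr fun h => hF (MvPolynomial.support_eq_empty.mp h)
  intro h0
  have hmem := (Perm2Bound.mem_support_chartTransform_iff hj hq (hq e he)).mpr he
  rw [h0, MvPolynomial.support_zero] at hmem
  exact Finset.notMem_empty _ hmem

omit [Fintype σ] in
/-- **The step polynomial is never zero**: for `F ≠ 0` CLEAN (`HauserPerlega.IsClean p F`), `p ≤ ord_{(x_S)} F` and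
`j ∈ S`, `(CentreBlowup.step p S j b s).F ≠ 0` at EVERY point `b` of the chart. (The tree's
`CentreBlowup.step_F_ne_zero` is the fibre-over-the-origin case.) [folklore] -/
theorem step_F_ne_zero_of_isClean {S : Finset σ} {j : σ} (hj : j ∈ S) (b : σ → K) (s : CentreBlowup.CState σ K)
    (hF : s.F ≠ 0) (hclean : HauserPerlega.IsClean p s.F) (hperm : (p : ℕ∞) ≤ CentreBlowup.ordAlong S s.F) :
    (CentreBlowup.step p S j b s).F ≠ 0 := by
  have hq : ∀ e ∈ s.F.support, p ≤ CentreBlowup.degIn S e := fun e he => by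
    have h : CentreBlowup.ordAlong S s.F ≤ (CentreBlowup.degIn S e : ℕ∞) := Finset.inf_le he
    exact_mod_cast hperm.trans h
  have hcleanF : deletePthPowers p s.F = s.F := HauserPerlega.deletePthPowers_eq_self hclean
  have hclean' : deletePthPowers p (CentreBlowup.chartTransform p S j s.F) = CentreBlowup.chartTransform p S j s.F :=
    Perm2Bound.deletePthPowers_chartTransform hj hq hcleanF
  intro h0
  -- `(step).F = clean (F′(x + b)) = 0` ⇒ `clean (F′) = clean (F′(x + b)(x − b)) = 0` ⇒ `F′ = 0`
  have h1 : deletePthPowers p (PointBlowup.translate (-b)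
      (PointBlowup.translate b (CentreBlowup.chartTransform p S j s.F))) = 0 :=
    deletePthPowers_translate_eq_zero (-b) h0
  rw [MohAlong.translate_translate, neg_add_cancel, PointBlowup.translate_zero, hclean'] at h1
  exact chartTransform_ne_zero hj hF hperm h1

end StepNeZero

/-! ## §2 The edge dictionary -/

section Edge

variable {K : Type} [Field K] {p : ℕ} [hp : Fact p.Prime] [CharP K p] [DecidableEq K]
variable {S : Finset (Fin 4)} {W : Scheme.{0}} {π : W ⟶ P 4 K}

/-- **Equimultiple points over a permissible centre are edges of the frame**: for `F ≠ 0` clean and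
`IsPermissibleCentre p S F`, every `j ∈ S`, `b` with `b_j = 0` and `IsEquimultiplePoint p S j b s` gives
`PIDim4.Edge p S s (CentreBlowup.step p S j b s)`. [cite: HauserPerlega2019PRIMS, §2 (the blowup in the x₁-chart)] -/
theorem edge_step_of_isEquimultiplePoint (s : State K) (hF : s.F ≠ 0) (hclean : HauserPerlega.IsClean p s.F)
    (hS : IsPermissibleCentre p S s.F) {j : Fin 4} (hj : j ∈ S) {b : Fin 4 → K} (hbj : b j = 0)
    (heq : CentreBlowup.IsEquimultiplePoint p S j b s) : Edge p S s (CentreBlowup.step p S j b s) :=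
  ⟨j, b, hj, hbj, heq, step_F_ne_zero_of_isClean hj b s hF hclean hS.2, rfl⟩

/-- **TY-3f: closed order-`p` points over the centre are edges.** `K` algebraically closed of characteristic `p`;
`s` a presented state with `F ≠ 0` clean; `V(z, x_S)` Hironaka-permissible; `π : W → 𝔸⁵_K` ANY blowing up along it.
Every CLOSED point `w` of `W` lying over the centre at which the controlled transform `σᶜ((z^p + F), p)` has order
`≥ p` is `chartImm_j (a, b)` for some `j ∈ S`, a rational `(a, b)` with `a^p + F′_j(b) = 0`, and an EDGE
`Edge p S s (step p S j b s)` of the target frame. [cite: Hauser2010, §F (equiconstant points)]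
[cite: BierstoneGrigorievMilmanWlodarczyk2011, §3.2] -/
theorem exists_edge_of_le_idealOrder [IsAlgClosed K] (s : State K) (hF : s.F ≠ 0)
    (hclean : HauserPerlega.IsClean p s.F) (hS : IsPermissibleCentre p S s.F)
    (hπ : IsBlowup π (AffineCoordBlowup.𝓘Λ 4 K (insert 0 (Fin.succ '' (S : Set (Fin 4)))))) {w : W}
    (hw : IsClosed ({w} : Set W))
    (hwC : π w ∈ AffineCoordBlowup.CΛ 4 K (insert 0 (Fin.succ '' (S : Set (Fin 4)))))
    (hord : (p : ℕ∞) ≤ idealOrder (controlledTransform π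
      (AffineCoordBlowup.𝓘Λ 4 K (insert 0 (Fin.succ '' (S : Set (Fin 4))))) (hypSheaf p s.F) p) w) :
    ∃ (j : Fin 4) (hj : j ∈ S) (x : P 4 K) (a : K) (b : Fin 4 → K),
      AffineCoordBlowup.chartImm hπ (ChartDictionary.succ_mem_centreVars hj) x = w ∧
        x.asIdeal = MvPolynomial.vanishingIdeal K {(Fin.cons a b : Fin (4 + 1) → K)} ∧
          a ^ p + eval b (CentreBlowup.chartTransform p S j s.F) = 0 ∧
            Edge p S s (CentreBlowup.step p S j b s) := by
  obtain ⟨j, hj, x, a, b, hxw, hx, hab, heq⟩ :=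
    (le_idealOrder_controlledTransform_iff_exists_chart s hS.2 hπ hw).mp hord
  have hbj : b j = 0 := by
    rw [← X_succ_mem_asIdeal_iff j a b hx, ← π_chartImm_mem_CΛ_iff hπ hj x, hxw]
    exact hwC
  exact ⟨j, hj, x, a, b, hxw, hx, hab, edge_step_of_isEquimultiplePoint s hF hclean hS hj hbj heq⟩

/-- **Conversely, every edge is realised by a point of the blow-up**: for an edge `Edge p S s s'` with centre
`V(z, x_S)` permissible and `π` any blowing up along it (`K` algebraically closed), `s' = step p S j b s` for a point
`chartImm_j (a, b)` of `W` OVER THE CENTRE at which `σᶜ((z^p + F), p)` has order `≥ p` (`a = (−F′_j(b))^{1/p}`).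
[cite: Hauser2010, §F (equiconstant points)] -/
theorem exists_point_of_edge [IsAlgClosed K] (s s' : State K) (hS : IsPermissibleCentre p S s.F)
    (hπ : IsBlowup π (AffineCoordBlowup.𝓘Λ 4 K (insert 0 (Fin.succ '' (S : Set (Fin 4)))))) (h : Edge p S s s') :
    ∃ (j : Fin 4) (hj : j ∈ S) (b : Fin 4 → K) (a : K) (x : P 4 K),
      s' = CentreBlowup.step p S j b s ∧
        x.asIdeal = MvPolynomial.vanishingIdeal K {(Fin.cons a b : Fin (4 + 1) → K)} ∧
          π (AffineCoordBlowup.chartImm hπ (ChartDictionary.succ_mem_centreVars hj) x) ∈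
              AffineCoordBlowup.CΛ 4 K (insert 0 (Fin.succ '' (S : Set (Fin 4)))) ∧
            (p : ℕ∞) ≤ idealOrder (controlledTransform π
              (AffineCoordBlowup.𝓘Λ 4 K (insert 0 (Fin.succ '' (S : Set (Fin 4))))) (hypSheaf p s.F) p)
              (AffineCoordBlowup.chartImm hπ (ChartDictionary.succ_mem_centreVars hj) x) := by
  obtain ⟨j, b, hj, hbj, heq, -, rfl⟩ := h
  haveI : PerfectRing K p := PerfectField.toPerfectRing p
  obtain ⟨a, ha, -⟩ := existsUnique_pow_add_eq_zero (K := K) (p := p) (eval b (CentreBlowup.chartTransform p S j s.F))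
  let x : P 4 K := ⟨MvPolynomial.vanishingIdeal K {(Fin.cons a b : Fin (4 + 1) → K)}, inferInstance⟩
  have hx : x.asIdeal = MvPolynomial.vanishingIdeal K {(Fin.cons a b : Fin (4 + 1) → K)} := rfl
  refine ⟨j, hj, b, a, x, rfl, hx, ?_, ?_⟩
  · rw [π_chartImm_mem_CΛ_iff hπ hj x, X_succ_mem_asIdeal_iff j a b hx]
    exact hbj
  · exact (isEquimultiplePoint_iff_idealOrder_controlledTransform_ge hj s hS.2 hπ b a ha hx).mp heq

end Edge

end Equimultiple

end Summit.ResolutionOfSingularities.ResolutionOfSingularities.Theorems.PIDim4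

end
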